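import Literature.AnabelianGeometry.EtaleTheta.SettingModelChiGroupLevelHolds
import Literature.AnabelianGeometry.EtaleTheta.SettingModelChiCusp
import Literature.AnabelianGeometry.SemiGraphs.TemperedDeltaCompletion
import Literature.AnabelianGeometry.SemiGraphs.TemperedDecompositionCompact
import Literature.AnabelianGeometry.SemiGraphs.TemperedOpenMapping
import HarnessLib

/-!
# The χ-twisted root models of [EtTh] §1 (R78): the [SemiAnbd] §6 group-level package at the CUSPED model `curveχ′`
# and the η′-consequences at `curveχ` / `curveχ′` — all UNCONDITIONAL (proof-only)

Mochizuki, *Semi-graphs of anabelioids*, Publ. RIMS **42** (2006) [SemiAnbd], Ex. 3.10 pp. 43–45 («`Π`, `Δ`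
tempered … temp-slim»), §6 p. 69 («`1 → π₁^temp(X_K̄) → π₁^temp(X_K) → G_K → 1`», «the ∧ denotes profinite completion,
or, equivalently, closure in `Π_{X_K}`»), §6 p. 71 («`D_x` … compact») [cite: MochizukiSemiAnbd2006, §6 p.69];
[EtTh] §1 p. 13 («any decomposition group of a cusp») [cite: MochizukiEtTh2009, §1 p.13].  abc-iut cell, seat
abc-iut-w5-d111 (gen 4); R78 cluster.  PROOF-ONLY (0 definitions), by-name consequences of this seat's unconditional
`GroupLevelData (curveχ p)` (SettingModelChiGroupLevelHolds) at abc-iut-w5-d029's CUSPED variant `curveχ′ p`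
(SettingModelChiCusp: same `K`, `Π^tp`, `aug`, `Π`, `toHat`; one cusp with decomposition group `b^Ẑ ⋊ G_{ℚ_p}`) —
the FIRST `TemperedCurve p` in the tree with a closed point:

* **`nonempty_groupLevelData_curveχ'_holds`** — abc-iut-L3's parameter bundle (ruling η′) is inhabited at
  `curveχ′` with NO binder (fields transferred from `curveχ` along the `rfl`s `curveχ'_PiTemp` / `curveχ'_aug`);
  `exists_toTemperedArithmeticGroup_curveχ'_holds`.
* η′-consequences, now theorems at both χ-models: **`isCompact_decomp_curveχ'`** / `decompCompact_curveχ'` /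
  **`isCompact_cuspDecompχ`** (the Tate-twisted cusp decomposition group `b^Ẑ ⋊ G_{ℚ_p}` is COMPACT — this seat's
  `TemperedCurve.isCompact_decomp_of_isTempered`, p417615), `isOpenMap_aug_curveχ'`,
  **`ker_augHat_eq_deltaHat_curveχ'`** / `…_curveχ` (exactness of `1 → Δ_X → Π_X → G_K`, abc-iut-w5-d139's
  `TemperedCurve.ker_augHat_eq_deltaHat`, p419295 = field (P1) of `OncePuncturedData`),
  **`isProfiniteCompletion_deltaToHat_curveχ'`** / `…_curveχ` (`Δ_X` IS the profinite completion of `Δ^tp_X`).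
With abc-iut-w5-d029's (P2)–(P4) clauses (`exists_isCusp_curveχ'`, `gfpSnd_left_eq_one_of_mem_decomp_curveχ'`,
`map_aug_decomp_curveχ'`) this leaves, for a `ThetaSetting` over `curveχ′`, only the guard (P5) between the model
and a fully inhabited `OncePuncturedData`.
HONEST LABEL: semi-synthetic models (not the tempered `π₁` of a curve) — consistency evidence only; classical
topological group theory; nothing of [EtTh]/[SemiAnbd] asserted; no side taken on [IUTchIII] Cor. 3.12.
-/

noncomputable section

namespace Literature.AnabelianGeometry.EtaleTheta.SettingModel

open Literature.AnabelianGeometry.SemiGraphs Literature.AlgebraicGeometry.Frobenioids _root_.Topology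

variable (p : ℕ) [Fact p.Prime]

/-! ### The group-level bundle at the cusped model `curveχ′` -/

/-- **`GroupLevelData (curveχ′ p)` is inhabited, unconditionally**: `curveχ′` has the same `K`, `Π^tp = Γ ⋊_χ G_{ℚ_p}`
and `aug` as `curveχ` (`rfl`), so this seat's temperedness/slimness/countability theorems transfer field by field.
[cite: MochizukiSemiAnbd2006, Ex 3.10 p.45] -/
theorem nonempty_groupLevelData_curveχ'_holds : Nonempty (TemperedCurve.GroupLevelData (curveχ' p)) := by
  have hker : ((curveχ' p).augK (curveχ' p).galoisIdentification).toMonoidHom.ker = (curveχ' p).DeltaTemp :=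
    (curveχ' p).ker_augK _
  refine ⟨{ galEquiv := (curveχ' p).galoisIdentification
            isTempered := isTempered_piTemp_curveχ p
            isTempered_ker := by rw [hker, curveχ'_deltaTemp]; exact isTempered_deltaTemp_curveχ p
            isSlimGroup := isSlimGroup_PiTpχ_holds p
            isSlimGroup_ker := by rw [hker, curveχ'_deltaTemp]; exact isSlimGroup_deltaTempχ_holds p
            secondCountableTopology := secondCountableTopology_PiTpχ p }⟩

/-- The bridge of ruling η fires at the cusped χ-model: a `TemperedArithmeticGroup ℚ_p`-datum with
`Π := Γ ⋊_χ G_{ℚ_p}`. [cite: MochizukiSemiAnbd2006, Ex 3.10 p.43] -/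
theorem exists_toTemperedArithmeticGroup_curveχ'_holds :
    ∃ d : TemperedCurve.GroupLevelData (curveχ' p), ((curveχ' p).toTemperedArithmeticGroup d).Pi = PiTpχ p :=
  ⟨(nonempty_groupLevelData_curveχ'_holds p).some, rfl⟩

/-! ### η′-consequences at `curveχ′`: compact cusp decomposition groups, open augmentation -/

/-- **The decomposition group of the cusp of `curveχ′` is COMPACT** ([SemiAnbd] §6 p. 71, tacit; [IUTchI] Cor. 2.5
proof «Since `D_x` is compact»): this seat's `TemperedCurve.isCompact_decomp_of_isTempered` (p417615) at the
tempered, Galois-countable `Π^tp_X = Γ ⋊_χ G_{ℚ_p}`. [cite: MochizukiSemiAnbd2006, §6 p.71] -/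
theorem isCompact_decomp_curveχ' (x : (curveχ' p).Pt) : IsCompact ((curveχ' p).decomp x : Set (curveχ' p).PiTemp) := by
  haveI : SecondCountableTopology (curveχ' p).PiTemp := secondCountableTopology_PiTpχ p
  exact (curveχ' p).isCompact_decomp_of_isTempered (isTempered_piTemp_curveχ p) x

/-- `Thm68Sub.DecompCompact (curveχ′ p)` (T68-B1 of SUBDAG-SemiAnbd-Thm68) holds. [cite: MochizukiSemiAnbd2006, §6 p.71] -/
theorem decompCompact_curveχ' : Thm68Sub.DecompCompact (curveχ' p) :=
  (curveχ' p).decompCompact_of_groupLevelData (nonempty_groupLevelData_curveχ'_holds p).some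

/-- **The Tate-twisted cusp decomposition group `b^Ẑ ⋊ G_{ℚ_p} ≤ Γ ⋊_χ G_{ℚ_p}` is compact** (abc-iut-w5-d029's
`cuspDecompχ p`, `= (curveχ′ p).decomp ()` by `rfl`). [cite: MochizukiSemiAnbd2006, §6 p.71] -/
theorem isCompact_cuspDecompχ : IsCompact (cuspDecompχ p : Set (PiTpχ p)) :=
  isCompact_decomp_curveχ' p ()

/-- The augmentation of `curveχ′` is an open map (= `isOpenMap_augχ`; equivalently from the bundle by this seat's
open mapping theorem `TemperedCurve.isOpenMap_aug_of_groupLevelData`). [cite: MochizukiSemiAnbd2006, §6 p.69] -/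
theorem isOpenMap_aug_curveχ' : IsOpenMap (curveχ' p).aug :=
  (curveχ' p).isOpenMap_aug_of_groupLevelData (nonempty_groupLevelData_curveχ'_holds p).some

/-! ### η′-consequences at both χ-models: exactness of the completed sequence, `Δ_X = (Δ^tp_X)^∧` -/

/-- **Exactness of `1 → Δ_X → Π_X → G_K` at `curveχ′`**: `Ker(augHat) = Δ_X` — the field (P1) `ker_augHat` of
`ThetaSetting.OncePuncturedData`, by abc-iut-w5-d139's `TemperedCurve.ker_augHat_eq_deltaHat` (p419295) at the
bundle. [cite: MochizukiSemiAnbd2006, §6 p.69] -/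
theorem ker_augHat_eq_deltaHat_curveχ' : (curveχ' p).augHat.toMonoidHom.ker = (curveχ' p).DeltaHat :=
  (curveχ' p).ker_augHat_eq_deltaHat (nonempty_groupLevelData_curveχ'_holds p).some

/-- The same at `curveχ`. [cite: MochizukiSemiAnbd2006, §6 p.69] -/
theorem ker_augHat_eq_deltaHat_curveχ : (curveχ p).augHat.toMonoidHom.ker = (curveχ p).DeltaHat :=
  (curveχ p).ker_augHat_eq_deltaHat (nonempty_groupLevelData_curveχ_holds p).some

/-- **`Δ_X` is the profinite completion of `Δ^tp_X` at `curveχ′`** ([SemiAnbd] §6 p. 73 «the ∧ denotes profinite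
completion, or, equivalently, closure in `Π_{X_K}`»): abc-iut-w5-d139's `TemperedCurve.isProfiniteCompletion_deltaToHat`
at the bundle. [cite: MochizukiSemiAnbd2006, §6 p.73] -/
theorem isProfiniteCompletion_deltaToHat_curveχ' : IsProfiniteCompletion (curveχ' p).deltaToHat :=
  (curveχ' p).isProfiniteCompletion_deltaToHat (nonempty_groupLevelData_curveχ'_holds p).some

/-- The same at `curveχ`. [cite: MochizukiSemiAnbd2006, §6 p.73] -/
theorem isProfiniteCompletion_deltaToHat_curveχ : IsProfiniteCompletion (curveχ p).deltaToHat :=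
  (curveχ p).isProfiniteCompletion_deltaToHat (nonempty_groupLevelData_curveχ_holds p).some

end Literature.AnabelianGeometry.EtaleTheta.SettingModel

end
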